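import Literature.Computability.AlgebraicComplexity.DefinableVNP
import Literature.Computability.AlgebraicComplexity.BooleanGadgetsTau
import HarnessLib

/-!
# Koiran's generalized Valiant criterion, constant-free: the witness and its Boolean sum

Towards the discharge of the named fact `Burgisser2009_thm41_koiranStep` (`BurgisserTransfer.lean`:
the application of Bürgisser 2009, Thm. 2.11 = Koiran 2004, Thm. 6.1 in the proof of Thm. 4.1(2)):
for `p, q` polynomially bounded with `p(n) ≥ n` and a 0/1 array `b(n, k, j)` decided in `P/poly` on
its index domain through the query words `encBitQuery n k j true`, the two-block polynomials
`B_n = twoBlockPoly p q b n` are substitution instances of ONE `VNP⁰` family `(G_{ℓ,μ})`.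

This file constructs, for one pair `(ℓ, μ)` of digit counts and a `B₂`-circuit family `CF`
(parameters `KParams`), the `VP⁰`-witness-to-be `gK` in the variables
`KoiranVars ℓ μ ⊕ BV` (`BV`: the `ℓ` bits of `j`, the `μ` bits of `k`, a transcript block of
size `M`) and computes its Boolean sum (Valiant's `boolSum` over `BV`):

  `gK = (∑_{a ≤ ℓ+μ} ∑_{c ≤ μ} ∑_{d ≤ ℓ} TERM a c d) · YSEL · ZSEL`,
  `TERM a c d = [|n|₂ = a] [|k|₂ = c] [|j|₂ = d] [j ≤ P] [k ≤ Q] · (VALID · OUT)(C_m; word_{a,c,d})`,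

where `|·|₂ = Nat.size` is the binary length (`lenInd`), the comparisons are `leInd`
(`BooleanGadgetsTau.lean`), `word_{a,c,d}` is the query word `⟨⟨bin n, bin k⟩, ⟨bin j, 1⟩⟩`
written with the digit VARIABLES `N, K, J` at the declared lengths (`wpolyK`), `C_m` the circuit at
that word length padded to `M` gates, `VALID · OUT` its transcript arithmetization
(`CircuitArithmetization.lean`) with the word substituted into the inputs and the block `W` into
the gate variables, and `YSEL = ∏ (J_i Y_i + 1 - J_i)`, `ZSEL = ∏ (K_i Z_i + 1 - K_i)` select the
monomials `Y^j Z^k` (`selProd`).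

Main statement (`aeval_blockSubst_bsum_gK`): after the substitution `blockSubst p q n` of the digit
variables by the bits of `n, p(n), q(n)` (with `ℓ = bitLen (p n)`, `μ = bitLen (q n)`), the Boolean
sum of `gK` is `twoBlockPoly p q b n`, provided the circuits decide `b` on the index domain.
The `VP⁰` bounds and the family packaging are in `KoiranCriterion.lean`.

## References

* P. Bürgisser, *On defining integers and proving arithmetic circuit lower bounds*, Comput.
  Complexity 18 (2009) = ECCC TR06-113, Thm. 2.11 and the proof of Thm. 4.1(2) (p. 14–15);
  STACS 2007, LNCS 4393, Thm. 10.
* P. Koiran, *Valiant's model and the cost of computing integers*, Comput. Complexity 13 (2004),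
  Thm. 6.1 and its proof.
* P. Bürgisser, *Completeness and Reduction in Algebraic Complexity Theory* (2000), Prop. 2.20.
-/

noncomputable section

open MvPolynomial

universe u v w

namespace Literature.Computability.AlgebraicComplexity

open Complexity CircuitArith BoolGadgets _root_.Computability

namespace KoiranW

/-! ### Generic pairing of words over an alphabet with two distinguished letters -/

/-- `pairG ff tt x y = dup2 x ++ [ff, tt] ++ y`, the shape of `boolPair`. [cite: AroraBarak2009, §0.1] -/
def pairG {γ : Type*} (ff tt : γ) (x y : List γ) : List γ := DefVNP.dup2 x ++ [ff, tt] ++ y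

/-- `boolPair` is `pairG false true`. [cite: AroraBarak2009, §0.1] -/
theorem boolPair_eq_pairG (x y : List Bool) : boolPair x y = pairG false true x y := rfl

/-- Length of `pairG`. [folklore] -/
@[simp] theorem length_pairG {γ : Type*} (ff tt : γ) (x y : List γ) :
    (pairG ff tt x y).length = 2 * x.length + 2 + y.length := by
  simp [pairG]; omega

/-- `pairG` commutes with `map`. [folklore] -/
theorem map_pairG {γ δ : Type*} (f : γ → δ) (ff tt : γ) (x y : List γ) :
    (pairG ff tt x y).map f = pairG (f ff) (f tt) (x.map f) (y.map f) := by
  simp [pairG, DefVNP.map_dup2]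

/-! ### Parameters and variables of one member of the family -/

/-- The data of one member `G_{ℓ,μ}`: the digit counts `ℓ` (bits of `j` and of `p n`), `μ`
(bits of `k` and of `q n`), the transcript block size `M`, and the `B₂`-circuit family of the bit
array, of size `≤ M` at all word lengths `≤ 8 (ℓ + μ) + 9`. [cite: Burgisser2006, proof of Thm. 4.1(2)] -/
structure KParams where
  /-- digits of `j` / `p n` -/
  ℓ : ℕ
  /-- digits of `k` / `q n` -/
  μ : ℕ
  /-- transcript block size -/
  M : ℕ
  /-- the circuits of the bit array -/
  CF : CircuitFamily
  /-- basis `B₂` -/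
  har : ∀ m, (CF m).IsOver B2
  /-- size bound at the relevant lengths -/
  hM : ∀ m, m ≤ 8 * (ℓ + μ) + 9 → (CF m).size ≤ M

variable (π : KParams)

/-- The Boolean (summation) variables: bits of `j`, bits of `k`, transcript block. [cite: Burgisser2006, proof of Thm. 4.1(2)] -/
abbrev BV : Type := Fin π.ℓ ⊕ (Fin π.μ ⊕ Fin π.M)

/-- The digit variables: bits of `n` (`ℓ + μ` of them), of `p n` (`ℓ`), of `q n` (`μ`) — the second
summand of `KoiranVars ℓ μ`. [cite: Burgisser2006, proof of Thm. 4.1(2)] -/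
abbrev DG : Type := Fin (π.ℓ + π.μ) ⊕ (Fin π.ℓ ⊕ Fin π.μ)

/-- The variables of the scalar gadgets: digits and Booleans. [folklore] -/
abbrev D : Type := DG π ⊕ BV π

/-- All variables of the witness: `KoiranVars ℓ μ = (Y, Z) ⊕ DG` and the Booleans. [folklore] -/
abbrev V : Type := KoiranVars π.ℓ π.μ ⊕ BV π

/-- The embedding of the scalar variables into all variables. [folklore] -/
def ιD : D π → V π := Sum.map Sum.inr id

/-- Digit variable `N_i` (in `D`). [folklore] -/
def Nv (i : Fin (π.ℓ + π.μ)) : MvPolynomial (D π) ℤ := X (Sum.inl (Sum.inl i))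
/-- Digit variable `P_i`. [folklore] -/
def Pv (i : Fin π.ℓ) : MvPolynomial (D π) ℤ := X (Sum.inl (Sum.inr (Sum.inl i)))
/-- Digit variable `Q_i`. [folklore] -/
def Qv (i : Fin π.μ) : MvPolynomial (D π) ℤ := X (Sum.inl (Sum.inr (Sum.inr i)))
/-- Boolean variable `J_i` (bit `i` of `j`). [folklore] -/
def Jv (i : Fin π.ℓ) : MvPolynomial (D π) ℤ := X (Sum.inr (Sum.inl i))
/-- Boolean variable `K_i` (bit `i` of `k`). [folklore] -/
def Kv (i : Fin π.μ) : MvPolynomial (D π) ℤ := X (Sum.inr (Sum.inr (Sum.inl i)))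
/-- Transcript variable `W_m`. [folklore] -/
def Wv (m : Fin π.M) : MvPolynomial (D π) ℤ := X (Sum.inr (Sum.inr (Sum.inr m)))

/-- `N_t` or `0` out of range. [folklore] -/
def N' (t : ℕ) : MvPolynomial (D π) ℤ := if h : t < π.ℓ + π.μ then Nv π ⟨t, h⟩ else 0
/-- `J_t` or `0` out of range. [folklore] -/
def J' (t : ℕ) : MvPolynomial (D π) ℤ := if h : t < π.ℓ then Jv π ⟨t, h⟩ else 0
/-- `K_t` or `0` out of range. [folklore] -/
def K' (t : ℕ) : MvPolynomial (D π) ℤ := if h : t < π.μ then Kv π ⟨t, h⟩ else 0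

/-- A Boolean assignment from its three blocks. [folklore] -/
def join (jb : Fin π.ℓ → Bool) (kb : Fin π.μ → Bool) (w : Fin π.M → Bool) : BV π → Bool :=
  Sum.elim jb (Sum.elim kb w)

/-- The digits of three numbers `n, P, Q` (to be `n, p n, q n`) as Booleans. [cite: Burgisser2006, proof of Thm. 4.1(2)] -/
def digits (n P Q : ℕ) : DG π → Bool :=
  Sum.elim (fun i => n.testBit i) (Sum.elim (fun i => P.testBit i) fun i => Q.testBit i)

/-- The integer point of the scalar variables: digits of `n, P, Q` and a Boolean assignment. [folklore] -/
def ptD (n P Q : ℕ) (e : BV π → Bool) : D π → ℤ :=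
  toK ℤ ∘ Sum.elim (digits π n P Q) e

/-- Bit `t` of `j` or `false` out of range. [folklore] -/
def jb' (jb : Fin π.ℓ → Bool) (t : ℕ) : Bool := if h : t < π.ℓ then jb ⟨t, h⟩ else false
/-- Bit `t` of `k` or `false` out of range. [folklore] -/
def kb' (kb : Fin π.μ → Bool) (t : ℕ) : Bool := if h : t < π.μ then kb ⟨t, h⟩ else false
/-- Bit `t` of `n` restricted to the `ℓ + μ` digit positions. [folklore] -/
def nb' (n t : ℕ) : Bool := if t < π.ℓ + π.μ then n.testBit t else false

section EvalVars

variable (n P Q : ℕ) (jb : Fin π.ℓ → Bool) (kb : Fin π.μ → Bool) (w : Fin π.M → Bool)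

/-- `Nv` at the point. [folklore] -/
@[simp] theorem eval_Nv (i : Fin (π.ℓ + π.μ)) : eval (ptD π n P Q (join π jb kb w)) (Nv π i) = toK ℤ (n.testBit i) := by
  simp [Nv, ptD, digits]
/-- `Pv` at the point. [folklore] -/
@[simp] theorem eval_Pv (i : Fin π.ℓ) : eval (ptD π n P Q (join π jb kb w)) (Pv π i) = toK ℤ (P.testBit i) := by
  simp [Pv, ptD, digits]
/-- `Qv` at the point. [folklore] -/
@[simp] theorem eval_Qv (i : Fin π.μ) : eval (ptD π n P Q (join π jb kb w)) (Qv π i) = toK ℤ (Q.testBit i) := by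
  simp [Qv, ptD, digits]
/-- `Jv` at the point. [folklore] -/
@[simp] theorem eval_Jv (i : Fin π.ℓ) : eval (ptD π n P Q (join π jb kb w)) (Jv π i) = toK ℤ (jb i) := by
  simp [Jv, ptD, join]
/-- `Kv` at the point. [folklore] -/
@[simp] theorem eval_Kv (i : Fin π.μ) : eval (ptD π n P Q (join π jb kb w)) (Kv π i) = toK ℤ (kb i) := by
  simp [Kv, ptD, join]
/-- `Wv` at the point. [folklore] -/
@[simp] theorem eval_Wv (m : Fin π.M) : eval (ptD π n P Q (join π jb kb w)) (Wv π m) = toK ℤ (w m) := by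
  simp [Wv, ptD, join]
/-- `N'` at the point. [folklore] -/
theorem eval_N' (t : ℕ) : eval (ptD π n P Q (join π jb kb w)) (N' π t) = toK ℤ (nb' π n t) := by
  unfold N' nb'; split <;> simp_all
/-- `J'` at the point. [folklore] -/
theorem eval_J' (t : ℕ) : eval (ptD π n P Q (join π jb kb w)) (J' π t) = toK ℤ (jb' π jb t) := by
  unfold J' jb'; split <;> simp
/-- `K'` at the point. [folklore] -/
theorem eval_K' (t : ℕ) : eval (ptD π n P Q (join π jb kb w)) (K' π t) = toK ℤ (kb' π kb t) := by
  unfold K' kb'; split <;> simp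

end EvalVars

/-! ### The query words -/

/-- The word length for declared digit lengths `(a, c, d)` of `(n, k, j)`:
`|⟨⟨bin n, bin k⟩, ⟨bin j, 1⟩⟩| = 4a + 2c + 2d + 9`. [cite: Burgisser2006, §3] -/
def L (a c d : ℕ) : ℕ := 4 * a + 2 * c + 2 * d + 9

/-- The query word as polynomials (digit variables and the constants `0, 1`). [cite: Burgisser2006, proof of Thm. 4.1(2)] -/
def wpolyK (a c d : ℕ) : List (MvPolynomial (D π) ℤ) :=
  pairG 0 1 (pairG 0 1 (List.ofFn fun t : Fin a => N' π t) (List.ofFn fun t : Fin c => K' π t))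
    (pairG 0 1 (List.ofFn fun t : Fin d => J' π t) [1])

/-- The query word as bits. [cite: Burgisser2006, §3] -/
def wbitsK (a c d : ℕ) (n : ℕ) (jb : Fin π.ℓ → Bool) (kb : Fin π.μ → Bool) : List Bool :=
  pairG false true (pairG false true (List.ofFn fun t : Fin a => nb' π n t) (List.ofFn fun t : Fin c => kb' π kb t))
    (pairG false true (List.ofFn fun t : Fin d => jb' π jb t) [true])

/-- Length of the polynomial word. [folklore] -/
@[simp] theorem length_wpolyK (a c d : ℕ) : (wpolyK π a c d).length = L a c d := by
  simp [wpolyK, L]; omega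

/-- Length of the bit word. [folklore] -/
@[simp] theorem length_wbitsK (a c d n : ℕ) (jb : Fin π.ℓ → Bool) (kb : Fin π.μ → Bool) :
    (wbitsK π a c d n jb kb).length = L a c d := by
  simp [wbitsK, L]; omega

/-- **The polynomial word evaluates to the bit word.** [folklore] -/
theorem map_eval_wpolyK (n P Q : ℕ) (a c d : ℕ) (jb : Fin π.ℓ → Bool) (kb : Fin π.μ → Bool) (w : Fin π.M → Bool) :
    (wpolyK π a c d).map (eval (ptD π n P Q (join π jb kb w))) = (wbitsK π a c d n jb kb).map (toK ℤ) := by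
  have hN : (List.ofFn fun t : Fin a => N' π t).map (eval (ptD π n P Q (join π jb kb w))) =
      (List.ofFn fun t : Fin a => nb' π n t).map (toK ℤ) := by
    rw [List.map_ofFn, List.map_ofFn]; congr 1; funext t; exact eval_N' π n P Q jb kb w t
  have hK : (List.ofFn fun t : Fin c => K' π t).map (eval (ptD π n P Q (join π jb kb w))) =
      (List.ofFn fun t : Fin c => kb' π kb t).map (toK ℤ) := by
    rw [List.map_ofFn, List.map_ofFn]; congr 1; funext t; exact eval_K' π n P Q jb kb w t
  have hJ : (List.ofFn fun t : Fin d => J' π t).map (eval (ptD π n P Q (join π jb kb w))) =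
      (List.ofFn fun t : Fin d => jb' π jb t).map (toK ℤ) := by
    rw [List.map_ofFn, List.map_ofFn]; congr 1; funext t; exact eval_J' π n P Q jb kb w t
  unfold wpolyK wbitsK
  rw [map_pairG, map_pairG, map_pairG, hN, hK, hJ, map_pairG, map_pairG, map_pairG, List.map_cons, List.map_nil,
    List.map_cons, List.map_nil, map_one, map_zero, toK_true, toK_false]

/-- The bit word as a function on positions. [folklore] -/
def wfun (a c d n : ℕ) (jb : Fin π.ℓ → Bool) (kb : Fin π.μ → Bool) : Fin (L a c d) → Bool :=
  fun i => (wbitsK π a c d n jb kb).getD i false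

/-- The list of the `Nat.size v` low bits of `v` read through a total bit function agreeing with
`testBit` below the size. [folklore] -/
theorem ofFn_eq_encodeNat {v s : ℕ} (f : ℕ → Bool) (hs : Nat.size v = s) (hf : ∀ t < s, f t = v.testBit t) :
    (List.ofFn fun t : Fin s => f t) = encodeNat v := by
  rw [DefVNP.encodeNat_eq_ofFn, hs]
  congr 1
  funext t
  exact hf t t.isLt

/-- **The bit word is Bürgisser's query word** `encBitQuery n k j true` when the declared lengths are
the binary lengths of `n`, `k = Nat.ofBits kb`, `j = Nat.ofBits jb` and `n < 2^{ℓ+μ}`. [cite: Burgisser2006, §3] -/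
theorem wbitsK_eq_encBitQuery {n : ℕ} (hn : n < 2 ^ (π.ℓ + π.μ)) (jb : Fin π.ℓ → Bool) (kb : Fin π.μ → Bool) :
    wbitsK π (Nat.size n) (Nat.size (Nat.ofBits kb)) (Nat.size (Nat.ofBits jb)) n jb kb =
      encBitQuery n (Nat.ofBits kb) (Nat.ofBits jb) true := by
  rw [encBitQuery, encIdx, boolPair_eq_pairG, boolPair_eq_pairG, boolPair_eq_pairG, wbitsK]
  have hN : (List.ofFn fun t : Fin (Nat.size n) => nb' π n t) = encodeNat n :=
    ofFn_eq_encodeNat (nb' π n) rfl fun t ht => by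
      have : t < π.ℓ + π.μ := lt_of_lt_of_le ht (Nat.size_le.2 hn)
      simp [nb', this]
  have hK : (List.ofFn fun t : Fin (Nat.size (Nat.ofBits kb)) => kb' π kb t) = encodeNat (Nat.ofBits kb) :=
    ofFn_eq_encodeNat (kb' π kb) rfl fun t ht => by
      have : t < π.μ := lt_of_lt_of_le ht (Nat.size_le.2 (Nat.ofBits_lt_two_pow kb))
      simp [kb', this]
  have hJ : (List.ofFn fun t : Fin (Nat.size (Nat.ofBits jb)) => jb' π jb t) = encodeNat (Nat.ofBits jb) :=
    ofFn_eq_encodeNat (jb' π jb) rfl fun t ht => by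
      have : t < π.ℓ := lt_of_lt_of_le ht (Nat.size_le.2 (Nat.ofBits_lt_two_pow jb))
      simp [jb', this]
  rw [hN, hK, hJ]

/-! ### The circuits and the transcript gadget -/

/-- The bit-array circuit at word length `L a c d`, padded to `M` gates. [cite: Burgisser2006, proof of Thm. 4.1(2)] -/
def Qw (a c d : ℕ) : Circuit (Fin (L a c d)) := (π.CF (L a c d)).padTo π.M

/-- The padded circuits are `B₂`-circuits. [folklore] -/
theorem isOver_Qw (a c d : ℕ) : (Qw π a c d).IsOver B2 := Circuit.isOver_B2_padTo _ _ (π.har _)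

/-- In range, the padded circuit has exactly `M` gates. [folklore] -/
theorem size_Qw {a c d : ℕ} (ha : a ≤ π.ℓ + π.μ) (hc : c ≤ π.μ) (hd : d ≤ π.ℓ) : (Qw π a c d).size = π.M :=
  Circuit.size_padTo _ (π.hM _ (by unfold L; omega))

/-- The substitution feeding the word into the inputs and the block `W` into the gate variables. [cite: Burgisser2006, proof of Thm. 4.1(2)] -/
def σw (a c d : ℕ) : Fin (L a c d) ⊕ Fin (Qw π a c d).size → MvPolynomial (D π) ℤ :=
  Sum.elim (fun i => (wpolyK π a c d).getD i 0) (fun m => if h : m.val < π.M then Wv π ⟨m.val, h⟩ else 0)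

/-- Membership in `dup2`. [folklore] -/
theorem mem_dup2_iff {γ : Type*} (f : γ) (l : List γ) : f ∈ DefVNP.dup2 l ↔ f ∈ l := by
  simp [DefVNP.dup2, List.mem_flatMap]

/-- Membership in `pairG`. [folklore] -/
theorem mem_pairG {γ : Type*} {ff tt f : γ} {x y : List γ} (h : f ∈ pairG ff tt x y) :
    f ∈ x ∨ f ∈ y ∨ f = ff ∨ f = tt := by
  simp only [pairG, List.mem_append, mem_dup2_iff, List.mem_cons, List.mem_nil_iff, or_false] at h
  tauto

/-- Every letter of the polynomial word is a leaf (a digit variable or the constant `0` or `1`). [folklore] -/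
theorem hasTauDeg_of_mem_wpolyK {a c d : ℕ} {f : MvPolynomial (D π) ℤ} (hf : f ∈ wpolyK π a c d) :
    HasTauDeg f 0 1 := by
  have hN : ∀ t, HasTauDeg (N' π t) 0 1 := fun t => by
    unfold N'; split
    · exact HasTauDeg.X _
    · exact HasTauDeg.zero
  have hK : ∀ t, HasTauDeg (K' π t) 0 1 := fun t => by
    unfold K'; split
    · exact HasTauDeg.X _
    · exact HasTauDeg.zero
  have hJ : ∀ t, HasTauDeg (J' π t) 0 1 := fun t => by
    unfold J'; split
    · exact HasTauDeg.X _
    · exact HasTauDeg.zero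
  rcases mem_pairG hf with h | h | rfl | rfl
  · rcases mem_pairG h with h | h | rfl | rfl
    · obtain ⟨t, rfl⟩ := (List.mem_ofFn' _ _).1 h
      exact hN t
    · obtain ⟨t, rfl⟩ := (List.mem_ofFn' _ _).1 h
      exact hK t
    · exact HasTauDeg.zero
    · exact HasTauDeg.one
  · rcases mem_pairG h with h | h | rfl | rfl
    · obtain ⟨t, rfl⟩ := (List.mem_ofFn' _ _).1 h
      exact hJ t
    · rw [List.mem_singleton] at h
      subst h
      exact HasTauDeg.one
    · exact HasTauDeg.zero
    · exact HasTauDeg.one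
  · exact HasTauDeg.zero
  · exact HasTauDeg.one

/-- Every substituted wire is a leaf: a variable or the constant `0` or `1`. [folklore] -/
theorem hasTauDeg_σw (a c d : ℕ) (v : Fin (L a c d) ⊕ Fin (Qw π a c d).size) : HasTauDeg (σw π a c d v) 0 1 := by
  cases v with
  | inl i =>
    simp only [σw, Sum.elim_inl]
    rw [List.getD_eq_getElem?_getD]
    cases h : (wpolyK π a c d)[i.val]? with
    | none => exact HasTauDeg.zero
    | some f => exact hasTauDeg_of_mem_wpolyK π (List.mem_of_getElem? h)
  | inr m =>
    simp only [σw, Sum.elim_inr]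
    split
    · exact HasTauDeg.X _
    · exact HasTauDeg.zero

/-- **The transcript gadget** `ACC = (VALID · OUT)(C_m; word)`. [cite: Burgisser2006, proof of Thm. 4.1(2)] -/
def ACC (a c d : ℕ) : MvPolynomial (D π) ℤ := bind₁ (σw π a c d) (arith (Qw π a c d))

/-- **The term of the digit lengths `(a, c, d)`.** [cite: Burgisser2006, proof of Thm. 4.1(2)] -/
def TERM (a c d : ℕ) : MvPolynomial (D π) ℤ :=
  lenInd (Nv π) a * lenInd (Kv π) c * lenInd (Jv π) d * leInd π.ℓ (Jv π) (Pv π) * leInd π.μ (Kv π) (Qv π) *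
    ACC π a c d

/-- The scalar gadget: the sum of the terms over the declared lengths. [cite: Burgisser2006, proof of Thm. 4.1(2)] -/
def TERMSUM : MvPolynomial (D π) ℤ :=
  ∑ a ∈ Finset.range (π.ℓ + π.μ + 1), ∑ c ∈ Finset.range (π.μ + 1), ∑ d ∈ Finset.range (π.ℓ + 1), TERM π a c d

/-- The `Y`-monomial selector `∏ (J_i Y_i + 1 - J_i)`. [cite: Burgisser2006, proof of Thm. 4.1(2)] -/
def YSEL : MvPolynomial (V π) ℤ :=
  selProd (fun i : Fin π.ℓ => X (Sum.inr (Sum.inl i))) fun i => X (Sum.inl (Sum.inl (Sum.inl i)))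

/-- The `Z`-monomial selector `∏ (K_i Z_i + 1 - K_i)`. [cite: Burgisser2006, proof of Thm. 4.1(2)] -/
def ZSEL : MvPolynomial (V π) ℤ :=
  selProd (fun i : Fin π.μ => X (Sum.inr (Sum.inr (Sum.inl i)))) fun i => X (Sum.inl (Sum.inl (Sum.inr i)))

/-- **The witness** `gK = TERMSUM · YSEL · ZSEL`. [cite: Burgisser2006, proof of Thm. 4.1(2)] -/
def gK : MvPolynomial (V π) ℤ := rename (ιD π) (TERMSUM π) * YSEL π * ZSEL π

/-! ### Values at a point -/

section Values

variable (n P Q : ℕ) (jb : Fin π.ℓ → Bool) (kb : Fin π.μ → Bool) (w : Fin π.M → Bool)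

/-- The transcript assignment read off the block `w`. [folklore] -/
def yOf {s : ℕ} (w : Fin π.M → Bool) : Fin s → Bool := fun m => if h : m.val < π.M then w ⟨m.val, h⟩ else false

/-- The substitution `σw` at the point is the Boolean point `(word, transcript)`. [folklore] -/
theorem eval_σw (a c d : ℕ) :
    (fun v => eval (ptD π n P Q (join π jb kb w)) (σw π a c d v)) = bpt ℤ (wfun π a c d n jb kb) (yOf π w) := by
  funext v
  cases v with
  | inl i =>
    simp only [σw, Sum.elim_inl, bpt, Function.comp_apply, wfun]
    have h := congrArg (fun l => l.getD i.val (0 : ℤ)) (map_eval_wpolyK π n P Q a c d jb kb w)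
    rw [show (0 : ℤ) = eval (ptD π n P Q (join π jb kb w)) 0 from (map_zero _).symm, List.getD_map] at h
    rw [h, show eval (ptD π n P Q (join π jb kb w)) (0 : MvPolynomial (D π) ℤ) = toK ℤ false by simp, List.getD_map]
  | inr m =>
    simp only [σw, Sum.elim_inr, bpt, Function.comp_apply, yOf]
    split <;> simp

/-- `ACC` at the point. [folklore] -/
theorem eval_ACC (a c d : ℕ) : eval (ptD π n P Q (join π jb kb w)) (ACC π a c d) =
    eval (bpt ℤ (wfun π a c d n jb kb) (yOf π w)) (arith (Qw π a c d)) := by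
  rw [ACC, DefVNP.eval_bind₁', eval_σw]

/-- Summing over the block `w` is summing over transcripts (in range). [folklore] -/
theorem sum_yOf {s : ℕ} (hs : s = π.M) (F : (Fin s → Bool) → ℤ) :
    ∑ w : Fin π.M → Bool, F (yOf π w) = ∑ y : Fin s → Bool, F y := by
  subst hs
  refine Finset.sum_congr rfl fun w _ => ?_
  congr 1; funext m; simp [yOf, m.isLt]

/-- **The transcript sum of `ACC`**: `∑_w ACC = [C_L(word)]` (in range). [cite: Burgisser2000, proof of Prop. 2.20] -/
theorem sum_eval_ACC {a c d : ℕ} (ha : a ≤ π.ℓ + π.μ) (hc : c ≤ π.μ) (hd : d ≤ π.ℓ) :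
    ∑ w : Fin π.M → Bool, eval (ptD π n P Q (join π jb kb w)) (ACC π a c d) =
      toK ℤ ((π.CF (L a c d)).eval (wfun π a c d n jb kb)) := by
  simp only [eval_ACC]
  rw [sum_yOf π (size_Qw π ha hc hd) (fun y => eval (bpt ℤ (wfun π a c d n jb kb) y) (arith (Qw π a c d))),
    sum_eval_arith _ (isOver_Qw π a c d), Qw, Circuit.eval_padTo]

/-- The indicator part of `TERM` at the point. [folklore] -/
theorem eval_indicators (a c d : ℕ) :
    eval (ptD π n P Q (join π jb kb w))
      (lenInd (Nv π) a * lenInd (Kv π) c * lenInd (Jv π) d * leInd π.ℓ (Jv π) (Pv π) * leInd π.μ (Kv π) (Qv π)) =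
      toK ℤ (decide (Nat.size (n % 2 ^ (π.ℓ + π.μ)) = a)) * toK ℤ (decide (Nat.size (Nat.ofBits kb) = c)) *
        toK ℤ (decide (Nat.size (Nat.ofBits jb) = d)) * toK ℤ (decide (Nat.ofBits jb ≤ P % 2 ^ π.ℓ)) *
          toK ℤ (decide (Nat.ofBits kb ≤ Q % 2 ^ π.μ)) := by
  rw [map_mul, map_mul, map_mul, map_mul,
    eval_lenInd (Nv π) _ (fun i => n.testBit i) (fun t => eval_Nv π n P Q jb kb w t),
    eval_lenInd (Kv π) _ kb (fun t => eval_Kv π n P Q jb kb w t),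
    eval_lenInd (Jv π) _ jb (fun t => eval_Jv π n P Q jb kb w t),
    eval_leInd _ π.ℓ (Jv π) (Pv π) jb (fun i => P.testBit i) (fun t => eval_Jv π n P Q jb kb w t)
      (fun t => eval_Pv π n P Q jb kb w t),
    eval_leInd _ π.μ (Kv π) (Qv π) kb (fun i => Q.testBit i) (fun t => eval_Kv π n P Q jb kb w t)
      (fun t => eval_Qv π n P Q jb kb w t),
    Nat.ofBits_testBit, Nat.ofBits_testBit, Nat.ofBits_testBit]

/-- **`TERM` summed over the transcript block**, in range. [cite: Burgisser2006, proof of Thm. 4.1(2)] -/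
theorem sum_eval_TERM {a c d : ℕ} (ha : a ≤ π.ℓ + π.μ) (hc : c ≤ π.μ) (hd : d ≤ π.ℓ) :
    ∑ w : Fin π.M → Bool, eval (ptD π n P Q (join π jb kb w)) (TERM π a c d) =
      toK ℤ (decide (Nat.size (n % 2 ^ (π.ℓ + π.μ)) = a)) * toK ℤ (decide (Nat.size (Nat.ofBits kb) = c)) *
        toK ℤ (decide (Nat.size (Nat.ofBits jb) = d)) * toK ℤ (decide (Nat.ofBits jb ≤ P % 2 ^ π.ℓ)) *
          toK ℤ (decide (Nat.ofBits kb ≤ Q % 2 ^ π.μ)) *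
        toK ℤ ((π.CF (L a c d)).eval (wfun π a c d n jb kb)) := by
  have h : ∀ w : Fin π.M → Bool, eval (ptD π n P Q (join π jb kb w)) (TERM π a c d) =
      toK ℤ (decide (Nat.size (n % 2 ^ (π.ℓ + π.μ)) = a)) * toK ℤ (decide (Nat.size (Nat.ofBits kb) = c)) *
        toK ℤ (decide (Nat.size (Nat.ofBits jb) = d)) * toK ℤ (decide (Nat.ofBits jb ≤ P % 2 ^ π.ℓ)) *
          toK ℤ (decide (Nat.ofBits kb ≤ Q % 2 ^ π.μ)) *
        eval (ptD π n P Q (join π jb kb w)) (ACC π a c d) := fun w => by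
    rw [TERM, map_mul, eval_indicators]
  simp only [h, ← Finset.mul_sum, sum_eval_ACC π n P Q jb kb ha hc hd]

end Values

/-! ### The Boolean sum after the digit substitution -/

section BSum

variable (n P Q : ℕ)

/-- The substitution of the digit variables of `KoiranVars ℓ μ` by the bits of `n, P, Q`
(`Y, Z` stay); `blockSubst p q n` is the case `P = p n`, `Q = q n`. [cite: Burgisser2006, proof of Thm. 4.1(2)] -/
def bsubN : KoiranVars π.ℓ π.μ → MvPolynomial (Fin π.ℓ ⊕ Fin π.μ) ℤ :=
  Sum.elim X fun dg => C (toK ℤ (digits π n P Q dg))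

/-- The combined substitution: digits by bits, Booleans by an assignment, `Y, Z` stay. [folklore] -/
def ψ (e : BV π → Bool) : V π → MvPolynomial (Fin π.ℓ ⊕ Fin π.μ) ℤ :=
  fun v => aeval (bsubN π n P Q) (DefVNP.φb (k := ℤ) e v)

/-- On the scalar variables the combined substitution is constant: the point `ptD`. [folklore] -/
theorem ψ_comp_ιD (e : BV π → Bool) : ψ π n P Q e ∘ ιD π = fun d => C (ptD π n P Q e d) := by
  funext d
  rcases d with dg | bv
  · simp [ψ, ιD, DefVNP.φb, bsubN, ptD]
  · simp [ψ, ιD, DefVNP.φb, bsubN, ptD]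

/-- The selected `Y`-monomial of a bit vector. [cite: Burgisser2006, proof of Thm. 4.1(2)] -/
def ysel (jb : Fin π.ℓ → Bool) : MvPolynomial (Fin π.ℓ ⊕ Fin π.μ) ℤ := ∏ i : Fin π.ℓ, (if jb i then X (Sum.inl i) else 1)

/-- The selected `Z`-monomial of a bit vector. [cite: Burgisser2006, proof of Thm. 4.1(2)] -/
def zsel (kb : Fin π.μ → Bool) : MvPolynomial (Fin π.ℓ ⊕ Fin π.μ) ℤ := ∏ i : Fin π.μ, (if kb i then X (Sum.inr i) else 1)

/-- `YSEL` under the combined substitution. [folklore] -/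
theorem aeval_ψ_YSEL (e : BV π → Bool) : aeval (ψ π n P Q e) (YSEL π) = ysel π (e ∘ Sum.inl) := by
  unfold YSEL ysel
  rw [aeval_selProd _ _ _ (e ∘ Sum.inl)]
  · refine Finset.prod_congr rfl fun t _ => ?_
    rw [aeval_X]; simp [ψ, DefVNP.φb, bsubN]
  · intro t; simp [ψ, DefVNP.φb, MvPolynomial.algebraMap_eq]

/-- `ZSEL` under the combined substitution. [folklore] -/
theorem aeval_ψ_ZSEL (e : BV π → Bool) :
    aeval (ψ π n P Q e) (ZSEL π) = zsel π (fun i => e (Sum.inr (Sum.inl i))) := by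
  unfold ZSEL zsel
  rw [aeval_selProd _ _ _ (fun i => e (Sum.inr (Sum.inl i)))]
  · refine Finset.prod_congr rfl fun t _ => ?_
    rw [aeval_X]; simp [ψ, DefVNP.φb, bsubN]
  · intro t; simp [ψ, DefVNP.φb, MvPolynomial.algebraMap_eq]

/-- **The substituted Boolean sum, first form.** [cite: Burgisser2006, proof of Thm. 4.1(2)] -/
theorem aeval_bsubN_bsum_eq_sum :
    aeval (bsubN π n P Q) (DefVNP.bsum (gK π)) =
      ∑ e : BV π → Bool, C (eval (ptD π n P Q e) (TERMSUM π)) * ysel π (e ∘ Sum.inl) *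
        zsel π (fun i => e (Sum.inr (Sum.inl i))) := by
  unfold DefVNP.bsum
  rw [map_sum]
  refine Finset.sum_congr rfl fun e _ => ?_
  rw [← AlgHom.comp_apply, MvPolynomial.comp_aeval]
  change aeval (ψ π n P Q e) (gK π) = _
  rw [gK, map_mul, map_mul, aeval_rename, ψ_comp_ιD, aeval_C_comp, aeval_ψ_YSEL, aeval_ψ_ZSEL]

/-- Splitting an assignment of the Boolean variables into its three blocks. [folklore] -/
def splitE : (BV π → Bool) ≃ (Fin π.ℓ → Bool) × ((Fin π.μ → Bool) × (Fin π.M → Bool)) :=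
  (Equiv.sumArrowEquivProdArrow _ _ _).trans
    (Equiv.prodCongr (Equiv.refl _) (Equiv.sumArrowEquivProdArrow _ _ _))

/-- The inverse of the splitting is `join`. [folklore] -/
theorem splitE_symm_apply (t : (Fin π.ℓ → Bool) × ((Fin π.μ → Bool) × (Fin π.M → Bool))) :
    (splitE π).symm t = join π t.1 t.2.1 t.2.2 := rfl

/-- **Summing over all Boolean assignments block by block.** [folklore] -/
theorem sum_BV {A : Type*} [AddCommMonoid A] (F : (BV π → Bool) → A) :
    ∑ e : BV π → Bool, F e =
      ∑ jb : Fin π.ℓ → Bool, ∑ kb : Fin π.μ → Bool, ∑ w : Fin π.M → Bool, F (join π jb kb w) := by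
  rw [← Fintype.sum_equiv (splitE π).symm (fun t => F ((splitE π).symm t)) F (fun _ => rfl),
    Fintype.sum_prod_type]
  refine Finset.sum_congr rfl fun jb _ => ?_
  rw [Fintype.sum_prod_type]
  rfl

/-- **The length triple sum has a single nonzero term.** [folklore] -/
theorem sum_lengths_eq3 {a₀ c₀ d₀ : ℕ} (ha : a₀ ≤ π.ℓ + π.μ) (hc : c₀ ≤ π.μ) (hd : d₀ ≤ π.ℓ) (K₁ K₂ : ℤ)
    (U : ℕ → ℕ → ℕ → ℤ) :
    ∑ a ∈ Finset.range (π.ℓ + π.μ + 1), ∑ c ∈ Finset.range (π.μ + 1), ∑ d ∈ Finset.range (π.ℓ + 1),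
      toK ℤ (decide (a₀ = a)) * toK ℤ (decide (c₀ = c)) * toK ℤ (decide (d₀ = d)) * K₁ * K₂ * U a c d =
      K₁ * K₂ * U a₀ c₀ d₀ := by
  rw [Finset.sum_eq_single a₀]
  · rw [Finset.sum_eq_single c₀]
    · rw [Finset.sum_eq_single d₀]
      · simp [toK]
      · intro d _ hne; rw [decide_eq_false (Ne.symm hne)]; simp [toK]
      · intro h; exact absurd (Finset.mem_range.2 (by omega)) h
    · intro c _ hne
      refine Finset.sum_eq_zero fun d _ => ?_
      rw [decide_eq_false (Ne.symm hne)]; simp [toK]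
    · intro h; exact absurd (Finset.mem_range.2 (by omega)) h
  · intro a _ hne
    refine Finset.sum_eq_zero fun c _ => Finset.sum_eq_zero fun d _ => ?_
    rw [decide_eq_false (Ne.symm hne)]; simp [toK]
  · intro h; exact absurd (Finset.mem_range.2 (by omega)) h

/-- The circuit's value on a list word. [folklore] -/
theorem eval_CF_list (x : List Bool) {m : ℕ} (h : x.length = m) :
    (π.CF m).eval (fun i : Fin m => x.getD i false) = (π.CF x.length).eval x.get := by
  subst h
  congr 1
  funext i
  exact List.getD_eq_getElem _ _ i.isLt

variable {n}

/-- **`TERMSUM` summed over the transcript block**: for `n < 2^{ℓ+μ}`, `P < 2^ℓ`, `Q < 2^μ`,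
`∑_w TERMSUM(digits, jb, kb, w) = [j ≤ P] [k ≤ Q] [C(⟨⟨bin n, bin k⟩, ⟨bin j, 1⟩⟩) = 1]`,
`j = Nat.ofBits jb`, `k = Nat.ofBits kb`. [cite: Burgisser2006, proof of Thm. 4.1(2)] -/
theorem sum_eval_TERMSUM (hn : n < 2 ^ (π.ℓ + π.μ)) (hP : P < 2 ^ π.ℓ) (hQ : Q < 2 ^ π.μ)
    (mem : List Bool → Bool) (hdec : ∀ x : List Bool, (π.CF x.length).eval x.get = mem x)
    (jb : Fin π.ℓ → Bool) (kb : Fin π.μ → Bool) :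
    ∑ w : Fin π.M → Bool, eval (ptD π n P Q (join π jb kb w)) (TERMSUM π) =
      toK ℤ (decide (Nat.ofBits jb ≤ P)) * toK ℤ (decide (Nat.ofBits kb ≤ Q)) *
        toK ℤ (mem (encBitQuery n (Nat.ofBits kb) (Nat.ofBits jb) true)) := by
  have hsn : Nat.size n ≤ π.ℓ + π.μ := Nat.size_le.2 hn
  have hsk : Nat.size (Nat.ofBits kb) ≤ π.μ := Nat.size_le.2 (Nat.ofBits_lt_two_pow kb)
  have hsj : Nat.size (Nat.ofBits jb) ≤ π.ℓ := Nat.size_le.2 (Nat.ofBits_lt_two_pow jb)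
  -- expand and swap the sums
  have hexp : ∀ w : Fin π.M → Bool, eval (ptD π n P Q (join π jb kb w)) (TERMSUM π) =
      ∑ a ∈ Finset.range (π.ℓ + π.μ + 1), ∑ c ∈ Finset.range (π.μ + 1), ∑ d ∈ Finset.range (π.ℓ + 1),
        eval (ptD π n P Q (join π jb kb w)) (TERM π a c d) := by
    intro w; simp only [TERMSUM, map_sum]
  simp only [hexp]
  rw [Finset.sum_comm]
  have step : ∀ a ∈ Finset.range (π.ℓ + π.μ + 1),
      ∑ w : Fin π.M → Bool, ∑ c ∈ Finset.range (π.μ + 1), ∑ d ∈ Finset.range (π.ℓ + 1),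
          eval (ptD π n P Q (join π jb kb w)) (TERM π a c d) =
        ∑ c ∈ Finset.range (π.μ + 1), ∑ d ∈ Finset.range (π.ℓ + 1),
          toK ℤ (decide (Nat.size (n % 2 ^ (π.ℓ + π.μ)) = a)) * toK ℤ (decide (Nat.size (Nat.ofBits kb) = c)) *
            toK ℤ (decide (Nat.size (Nat.ofBits jb) = d)) * toK ℤ (decide (Nat.ofBits jb ≤ P % 2 ^ π.ℓ)) *
              toK ℤ (decide (Nat.ofBits kb ≤ Q % 2 ^ π.μ)) *
            toK ℤ ((π.CF (L a c d)).eval (wfun π a c d n jb kb)) := by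
    intro a ha
    rw [Finset.sum_comm]
    refine Finset.sum_congr rfl fun c hc => ?_
    rw [Finset.sum_comm]
    refine Finset.sum_congr rfl fun d hd => ?_
    exact sum_eval_TERM π n P Q jb kb (by simpa [Nat.lt_succ_iff] using ha)
      (by simpa [Nat.lt_succ_iff] using hc) (by simpa [Nat.lt_succ_iff] using hd)
  rw [Finset.sum_congr rfl step]
  -- collapse the length sums
  simp only [Nat.mod_eq_of_lt hn, Nat.mod_eq_of_lt hP, Nat.mod_eq_of_lt hQ]
  rw [sum_lengths_eq3 π hsn hsk hsj]
  congr 1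
  -- the surviving word is the query word
  unfold wfun
  rw [eval_CF_list π _ (length_wbitsK π _ _ _ n jb kb), wbitsK_eq_encBitQuery π hn jb kb, hdec]

/-- The selected `Y`-monomial is the bit monomial of `Nat.ofBits jb`, renamed. [folklore] -/
theorem ysel_eq (jb : Fin π.ℓ → Bool) : ysel π jb = rename Sum.inl (bitMonomial π.ℓ (Nat.ofBits jb)) := by
  unfold ysel bitMonomial
  rw [map_prod]
  refine Finset.prod_congr rfl fun i _ => ?_
  rw [map_pow, rename_X, Nat.testBit_ofBits_lt _ _ i.isLt]
  cases jb i <;> simp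

/-- The selected `Z`-monomial is the bit monomial of `Nat.ofBits kb`, renamed. [folklore] -/
theorem zsel_eq (kb : Fin π.μ → Bool) : zsel π kb = rename Sum.inr (bitMonomial π.μ (Nat.ofBits kb)) := by
  unfold zsel bitMonomial
  rw [map_prod]
  refine Finset.prod_congr rfl fun i _ => ?_
  rw [map_pow, rename_X, Nat.testBit_ofBits_lt _ _ i.isLt]
  cases kb i <;> simp

/-- **The substituted Boolean sum of the witness**: for `n < 2^{ℓ+μ}`, `P < 2^ℓ`, `Q < 2^μ`,
`∑_e gK(bits, e) = ∑_{j < 2^ℓ} ∑_{k < 2^μ} [j ≤ P] [k ≤ Q] [C(⟨⟨bin n, bin k⟩, ⟨bin j, 1⟩⟩)] ·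
Y^{bits j} Z^{bits k}`. [cite: Burgisser2006, proof of Thm. 4.1(2)] -/
theorem aeval_bsubN_bsum_gK (hn : n < 2 ^ (π.ℓ + π.μ)) (hP : P < 2 ^ π.ℓ) (hQ : Q < 2 ^ π.μ)
    (mem : List Bool → Bool) (hdec : ∀ x : List Bool, (π.CF x.length).eval x.get = mem x) :
    aeval (bsubN π n P Q) (DefVNP.bsum (gK π)) =
      ∑ j ∈ Finset.range (2 ^ π.ℓ), ∑ k ∈ Finset.range (2 ^ π.μ),
        C (toK ℤ (decide (j ≤ P)) * toK ℤ (decide (k ≤ Q)) * toK ℤ (mem (encBitQuery n k j true))) *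
          (rename Sum.inl (bitMonomial π.ℓ j) * rename Sum.inr (bitMonomial π.μ k)) := by
  rw [aeval_bsubN_bsum_eq_sum, sum_BV]
  -- the selectors do not depend on the transcript block
  have hsel : ∀ (jb : Fin π.ℓ → Bool) (kb : Fin π.μ → Bool) (w : Fin π.M → Bool),
      C (eval (ptD π n P Q (join π jb kb w)) (TERMSUM π)) * ysel π (join π jb kb w ∘ Sum.inl) *
        zsel π (fun i => join π jb kb w (Sum.inr (Sum.inl i))) =
      C (eval (ptD π n P Q (join π jb kb w)) (TERMSUM π)) * (ysel π jb * zsel π kb) := by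
    intro jb kb w; rw [mul_assoc]; rfl
  simp only [hsel, ← Finset.sum_mul, ← map_sum]
  simp only [sum_eval_TERMSUM π P Q hn hP hQ mem hdec, ysel_eq, zsel_eq]
  -- reindex the bit vectors by their values
  rw [sum_boolVec_eq_sum_range (m := π.ℓ) (f := fun j => ∑ kb : Fin π.μ → Bool,
    C (toK ℤ (decide (j ≤ P)) * toK ℤ (decide (Nat.ofBits kb ≤ Q)) * toK ℤ (mem (encBitQuery n (Nat.ofBits kb) j true))) *
      (rename Sum.inl (bitMonomial π.ℓ j) * rename Sum.inr (bitMonomial π.μ (Nat.ofBits kb))))]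
  refine Finset.sum_congr rfl fun j _ => ?_
  exact sum_boolVec_eq_sum_range (m := π.μ) (f := fun k =>
    C (toK ℤ (decide (j ≤ P)) * toK ℤ (decide (k ≤ Q)) * toK ℤ (mem (encBitQuery n k j true))) *
      (rename Sum.inl (bitMonomial π.ℓ j) * rename Sum.inr (bitMonomial π.μ k)))

end BSum

end KoiranW

end Literature.Computability.AlgebraicComplexity
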